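import Literature.AlgebraicGeometry.Resolution.FlatSlicingCriterion
import Mathlib.RingTheory.Smooth.Locus
import Mathlib.RingTheory.Smooth.Flat
import Mathlib.RingTheory.Localization.AtPrime.Basic
import Mathlib.RingTheory.LocalRing.ResidueField.Ideal
import HarnessLib

/-!
# Flatness of a hypersurface slice at a point with transversal fibre

Topic: `Literature/AlgebraicGeometry/Resolution`. The flatness half of the local computation in
de Jong 1996, proof of Lemma 4.13 ("At each of the intersection points `x ∈ f⁻¹(y) ∩ H` we have
[`𝒪_{X,x}` smooth over `𝒪_{Y,y}`] since `f` is smooth at `x`. Further `H` is defined by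
`(h) ⊂ 𝒪_{X,x}` with `h̄ ∉ 𝔪²`, as `H ∩ f⁻¹(y)` [is reduced]. Therefore `f|_H` is [flat at
`x`]"), in ring-theoretic form: for a finitely presented algebra `R` over a Noetherian ring `A`,
`h ∈ R`, `S = R/(h)` and a prime `𝔔 ⊂ S` over `𝔭 ⊂ A` with preimage `𝔮 ⊂ R`, if `R` is smooth
over `A` at `𝔮`, the fibre `R_𝔮/𝔭R_𝔮` is a domain which is not a field, and the fibre
`S_𝔔/𝔭S_𝔔` is a field, then `S_𝔔` is flat over `A`. Proof: `R_𝔮` is flat over `A_𝔭`; the image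
`h̄` of `h` in the domain `R_𝔮/𝔭R_𝔮` is non-zero (otherwise `R_𝔮/𝔭R_𝔮 = S_𝔔/𝔭S_𝔔` would be
a field), hence a non-zero-divisor; so `R_𝔮/(h) ≅ S_𝔔` is flat over `A_𝔭` by Matsumura's
Corollary to Thm. 22.5 (`Matsumura1987.isSMulRegular_and_flat_quotient_of_isSMulRegular_fiber`,
`FlatSlicingCriterion.lean`).

* `flat_localization_quotient_span_singleton` — the statement above.

## Sources

* A. J. de Jong, *Smoothness, semi-stability and alterations*, Publ. Math. IHÉS 83 (1996),
  Lemma 4.13 (proof), p. 70. [DeJong1996]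
* H. Matsumura, *Commutative Ring Theory*, §22, Corollary to Thm. 22.5. [Matsumura1987]
-/

noncomputable section

open IsLocalRing

namespace Literature.AlgebraicGeometry.Resolution

universe u v

/-- The submonoid of `R/I` generated by the complement of the preimage `𝔮` of a prime `𝔔 ⊂ R/I`
is the complement of `𝔔`; hence `R_𝔮 / I R_𝔮` is the localisation of `R/I` at `𝔔`. [folklore] -/
theorem isLocalization_atPrime_comap_quotient {R : Type u} [CommRing R] (I : Ideal R)
    (𝔔 : Ideal (R ⧸ I)) [𝔔.IsPrime] :
    IsLocalization.AtPrime (Localization.AtPrime (𝔔.comap (Ideal.Quotient.mk I)) ⧸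
      I.map (algebraMap R (Localization.AtPrime (𝔔.comap (Ideal.Quotient.mk I))))) 𝔔 := by
  set 𝔮 := 𝔔.comap (Ideal.Quotient.mk I)
  have hM : Algebra.algebraMapSubmonoid (R ⧸ I) 𝔮.primeCompl = 𝔔.primeCompl := by
    ext b
    constructor
    · rintro ⟨c, hc, rfl⟩
      exact fun h => hc (Ideal.mem_comap.mpr h)
    · intro hb
      obtain ⟨c, rfl⟩ := Ideal.Quotient.mk_surjective b
      exact ⟨c, fun h => hb (Ideal.mem_comap.mp h), rfl⟩
  have := (inferInstance : IsLocalization (Algebra.algebraMapSubmonoid (R ⧸ I) 𝔮.primeCompl)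
    (Localization.AtPrime 𝔮 ⧸ I.map (algebraMap R (Localization.AtPrime 𝔮))))
  rwa [hM] at this

/-- **Flatness of the slice `R/(h)` at a point whose fibre is transversal** (de Jong 1996, proof
of Lemma 4.13, via Matsumura's Cor. to Thm. 22.5): `A` Noetherian, `R` a finitely presented
`A`-algebra, Noetherian, `h ∈ R`, `S = R/(h)`, `𝔔 ⊂ S` a prime over `𝔭 ⊂ A` with preimage
`𝔮 ⊂ R`; if `R` is smooth over `A` at `𝔮`, `R_𝔮/𝔭R_𝔮` is a domain and not a field, and
`S_𝔔/𝔭S_𝔔` is a field, then `S_𝔔` is flat over `A`. [cite: DeJong1996, Lemma 4.13 (proof), p. 70] -/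
theorem flat_localization_quotient_span_singleton {A : Type u} {R : Type u} [CommRing A]
    [CommRing R] [Algebra A R] [IsNoetherianRing A] [IsNoetherianRing R]
    [Algebra.FinitePresentation A R] (h : R) (𝔭 : Ideal A) [𝔭.IsPrime]
    (𝔔 : Ideal (R ⧸ Ideal.span {h})) [𝔔.IsPrime] [𝔔.LiesOver 𝔭]
    [Algebra.IsSmoothAt A (𝔔.comap (Ideal.Quotient.mk (Ideal.span {h})))]
    (hdom : IsDomain (Localization.AtPrime (𝔔.comap (Ideal.Quotient.mk (Ideal.span {h}))) ⧸
      𝔭.map (algebraMap A (Localization.AtPrime (𝔔.comap (Ideal.Quotient.mk (Ideal.span {h})))))))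
    (hnf : ¬ IsField (Localization.AtPrime (𝔔.comap (Ideal.Quotient.mk (Ideal.span {h}))) ⧸
      𝔭.map (algebraMap A (Localization.AtPrime (𝔔.comap (Ideal.Quotient.mk (Ideal.span {h})))))))
    (hfield : IsField (Localization.AtPrime 𝔔 ⧸ 𝔭.map (algebraMap A (Localization.AtPrime 𝔔)))) :
    Module.Flat A (Localization.AtPrime 𝔔) := by
  set 𝔮 : Ideal R := 𝔔.comap (Ideal.Quotient.mk (Ideal.span {h})) with h𝔮
  haveI h𝔮p : 𝔮.IsPrime := by rw [h𝔮]; infer_instance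
  set Ap := Localization.AtPrime 𝔭 with hAp
  set Rq := Localization.AtPrime 𝔮 with hRq
  set Sq := Localization.AtPrime 𝔔 with hSq
  -- `𝔮` lies over `𝔭`
  haveI : 𝔮.LiesOver 𝔭 := ⟨by
    rw [Ideal.LiesOver.over (p := 𝔭) (P := 𝔔), Ideal.under_def, Ideal.under_def, h𝔮,
      Ideal.comap_comap]
    rfl⟩
  /- Step 1: `R_𝔮` is flat over `A` (smooth at `𝔮`) -/
  haveI hflatRq : Module.Flat A Rq := by
    obtain ⟨r, hr, hsm⟩ := Algebra.IsSmoothAt.exists_notMem_smooth A 𝔮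
    haveI := hsm
    haveI : Module.Flat A (Localization.Away r) := inferInstance
    have hunit : IsUnit (algebraMap R Rq r) :=
      IsLocalization.map_units Rq (⟨r, show r ∈ 𝔮.primeCompl from hr⟩ : 𝔮.primeCompl)
    letI : Algebra (Localization.Away r) Rq := (IsLocalization.Away.lift r hunit).toAlgebra
    have hcomp : (algebraMap (Localization.Away r) Rq).comp (algebraMap R (Localization.Away r)) =
        algebraMap R Rq := IsLocalization.Away.lift_comp r hunit
    haveI : IsScalarTower R (Localization.Away r) Rq := .of_algebraMap_eq' hcomp.symm
    haveI : IsScalarTower A (Localization.Away r) Rq := .of_algebraMap_eq' <| by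
      rw [IsScalarTower.algebraMap_eq A R Rq, ← hcomp, RingHom.comp_assoc,
        ← IsScalarTower.algebraMap_eq A R (Localization.Away r)]
    haveI : IsLocalization (Submonoid.map (algebraMap R (Localization.Away r)) 𝔮.primeCompl) Rq :=
      IsLocalization.isLocalization_of_submonoid_le (Localization.Away r) Rq (Submonoid.powers r)
        𝔮.primeCompl (Submonoid.powers_le.mpr hr)
    haveI : Module.Flat (Localization.Away r) Rq := IsLocalization.flat Rq
      (Submonoid.map (algebraMap R (Localization.Away r)) 𝔮.primeCompl)
    exact Module.Flat.trans A (Localization.Away r) Rq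
  /- Step 2: the local homomorphism `A_𝔭 → R_𝔮` -/
  letI : Algebra Ap Rq := Localization.AtPrime.algebraOfLiesOver 𝔭 𝔮
  haveI : Module.Flat Ap Rq := (Module.flat_iff_of_isLocalization Ap 𝔭.primeCompl Rq).mpr hflatRq
  set h' : Rq := algebraMap R Rq h with hh'
  set J : Ideal Rq := (Ideal.span {h}).map (algebraMap R Rq) with hJ
  have hJh : J = Ideal.span {h'} := by rw [hJ, Ideal.map_span, Set.image_singleton]
  set 𝔭Rq : Ideal Rq := 𝔭.map (algebraMap A Rq) with h𝔭Rq
  have hmax𝔭 : (maximalIdeal Ap).map (algebraMap Ap Rq) = 𝔭Rq := by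
    rw [← Localization.AtPrime.map_eq_maximalIdeal, Ideal.map_map, ← IsScalarTower.algebraMap_eq]
  /- Step 3: `S_𝔔 ≅ R_𝔮 / J` and the fibre `S_𝔔/𝔭S_𝔔 ≅ R_𝔮/(J + 𝔭R_𝔮)` -/
  haveI : IsLocalization.AtPrime (Rq ⧸ J) 𝔔 :=
    isLocalization_atPrime_comap_quotient (Ideal.span {h}) 𝔔
  let E : (Rq ⧸ J) ≃ₐ[R ⧸ Ideal.span {h}] Sq := IsLocalization.algEquiv 𝔔.primeCompl (Rq ⧸ J) Sq
  haveI : IsScalarTower A (R ⧸ Ideal.span {h}) (Rq ⧸ J) := IsScalarTower.of_algebraMap_eq fun a => by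
    rw [IsScalarTower.algebraMap_apply A R (Rq ⧸ J) a,
      IsScalarTower.algebraMap_apply R (R ⧸ Ideal.span {h}) (Rq ⧸ J),
      ← IsScalarTower.algebraMap_apply A R (R ⧸ Ideal.span {h})]
  let EA : (Rq ⧸ J) ≃ₐ[A] Sq := E.restrictScalars A
  have hfib : IsField (Rq ⧸ (J ⊔ 𝔭Rq)) := by
    -- `S_𝔔/𝔭S_𝔔 ≅ (R_𝔮/J)/𝔭 ≅ R_𝔮/(J + 𝔭R_𝔮)`
    have e1 : (Rq ⧸ J) ⧸ 𝔭.map (algebraMap A (Rq ⧸ J)) ≃+* Sq ⧸ 𝔭.map (algebraMap A Sq) :=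
      Ideal.quotientEquiv _ _ EA.toRingEquiv (by
        rw [Ideal.map_map]
        congr 1
        ext a
        exact (EA.commutes a).symm)
    have e2 : (Rq ⧸ J) ⧸ 𝔭.map (algebraMap A (Rq ⧸ J)) ≃+* Rq ⧸ (J ⊔ 𝔭Rq) := by
      rw [show 𝔭.map (algebraMap A (Rq ⧸ J)) = 𝔭Rq.map (Ideal.Quotient.mk J) by
        rw [h𝔭Rq, Ideal.map_map]; rfl]
      exact DoubleQuot.quotQuotEquivQuotSup J 𝔭Rq
    exact MulEquiv.isField (MulEquiv.isField hfield e1.toMulEquiv) e2.symm.toMulEquiv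
  /- Step 4: `h̄ ≠ 0` in the domain `R_𝔮/𝔭R_𝔮`, hence a non-zero-divisor there -/
  have hh'ne : h' ∉ 𝔭Rq := by
    intro hmem
    have hle : J ≤ 𝔭Rq := by
      rw [hJh, Ideal.span_singleton_le_iff_mem]
      exact hmem
    have : IsField (Rq ⧸ 𝔭Rq) :=
      MulEquiv.isField hfib (Ideal.quotEquivOfEq (sup_eq_right.mpr hle).symm).toMulEquiv
    exact hnf this
  have hreg : IsSMulRegular (Rq ⧸ (maximalIdeal Ap).map (algebraMap Ap Rq)) h' := by
    rw [hmax𝔭, Matsumura1987.isSMulRegular_quotient_iff]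
    intro b hb
    haveI := hdom
    have h0 : Ideal.Quotient.mk 𝔭Rq h' * Ideal.Quotient.mk 𝔭Rq b = 0 := by
      rw [← map_mul, Ideal.Quotient.eq_zero_iff_mem]
      exact hb
    rcases mul_eq_zero.mp h0 with h1 | h1
    · exact absurd (Ideal.Quotient.eq_zero_iff_mem.mp h1) hh'ne
    · exact Ideal.Quotient.eq_zero_iff_mem.mp h1
  /- Step 5: the slicing criterion, and transport to `S_𝔔` -/
  have hflat : Module.Flat Ap (Rq ⧸ Ideal.span {h'}) :=
    (Matsumura1987.isSMulRegular_and_flat_quotient_of_isSMulRegular_fiber hreg).2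
  rw [← hJh] at hflat
  haveI := hflat
  haveI : Module.Flat A (Rq ⧸ J) := (Module.flat_iff_of_isLocalization Ap 𝔭.primeCompl (Rq ⧸ J)).mp hflat
  exact Module.Flat.of_linearEquiv (R := A) (M := Rq ⧸ J) (N := Sq) EA.symm.toLinearEquiv

end Literature.AlgebraicGeometry.Resolution

end
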